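import Summits.HodgeConjecture.HodgeConjecture.Theorems.SignSymmetricPowersSevenFacts
import Summits.HodgeConjecture.HodgeConjecture.Theorems.SignSymmetricPowersSignDeckHodgeKernel
import HarnessLib

/-!
# Crux K1-B `VeryGeneralSignCommutatorsInHg` (route `SignSymmetricPowers`, stmt-HodgeConjecture-19716) and the rung leaf
# `SignThreefoldPowersHodge` (19715) modulo the deck Hodge numbers, and modulo SEVEN facts with Griffiths' residue KERNEL

Prover seat `hodge-nonav-prover-Ax` (g4), cell `hodge-nonav`, 2026-08-27.  Landed `--supports stmt-HodgeConjecture-19716`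
(helper); sorry-free, no definition, no new named fact; CONDITIONAL results only — nothing here says HC ∕ HC_AV is proved,
rung F-H1 is not moved.

`SignSymmetricPowersSevenFacts.veryGeneralSignCommutatorsInHg_of_seven_facts` (this seat) closes K1-B from SEVEN named facts,
the first of which — Voisin's equivariant Jacobian-ring statement `voisin2003_finrank_eigenspace_inf_hodgePiece_of_diagonalStabilizer`
(dimension form) — enters ONLY through the registered stub `stub_signDeckHodge` (the `ι`-eigen-Hodge numbers of the very
general sign-symmetric threefold).  The tree carries a second named fact for the same piece of Griffiths–Voisin residue
theory, the kernel form `Griffiths1969_residueKernel_eq_jacobianIdeal` (Voisin II Thm. 6.10), from which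
`SignSymmetricPowersSignDeckHodgeKernel.stub_signDeckHodge_of_residueKernel` proves the stub's conclusion, and from which
prover-Bx derived route A's two Carlson–Toledo Hodge-number facts (`CyclicUnitaryPowersDeckHodgeOfGriffiths`), so that
route A's crux K1 is conditional on {CT family, Griffiths kernel, CT Thm 7.1, CDK} (`CyclicUnitaryPowersFourFacts`).

This file factors the seven-facts theorem through the stub's CONCLUSION:

* `veryGeneralSignCommutatorsInHg_of_signDeckHodge` — K1-B from the deck Hodge numbers (the registered signature of
  `stub_signDeckHodge`, taken as a hypothesis) and the six other facts (ZvK generation, uniform Picard–Lefschetz for nodal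
  forms, global invariant cycles, nodal local branches of the discriminant, CDK cover, the symmetric `A₃` vanishing lattice);
  the proof is the seven-facts proof verbatim with the Deck clauses assembled from `exists_signDeckModel_clauses_one_two`;
* `veryGeneralSignCommutatorsInHg_of_seven_facts_kernel` — **K1-B ⟸ {`Griffiths1969_residueKernel_eq_jacobianIdeal`, ZvK, PL,
  GIC, D1, CDK, B2}**, so that the two K1 cruxes of the cell bind ONE residue fact and the UNION of their fact lists is
  nine names; `signThreefoldPowersHodge_of_seven_facts_kernel` — the rung leaf likewise.  (The dimension-form
  seven-facts theorem is `veryGeneralSignCommutatorsInHg_of_signDeckHodge (stub_signDeckHodge hV)`.)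

## References

* [VoisinHodgeII2003] C. Voisin, Hodge Theory and Complex Algebraic Geometry II (2003), §6.1.3 Thm. 6.10 / Cor. 6.12.
* [CattaniDeligneKaplan1995] E. Cattani, P. Deligne, A. Kaplan, On the locus of Hodge classes, J. Amer. Math. Soc. 8
  (1995), Cor. 1.2.
* [Deligne1972K3] P. Deligne, La conjecture de Weil pour les surfaces K3, Invent. Math. 15 (1972), Prop. 7.5 (= CMSP 15.3.7,
  a theorem of the tree: `deligne_finiteIndex_monodromy_le_mumfordTateGroup_of_isQuasiProjectiveOver`).
-/

noncomputable section

-- mandated namespace `Summit.HodgeConjecture.HodgeConjecture.Theorems` trips `linter.dupNamespace` (off tree-wide)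
set_option linter.dupNamespace false
set_option maxHeartbeats 800000

namespace Summit.HodgeConjecture.HodgeConjecture.Theorems.SignSymmetricPowersSevenFactsKernel

open Literature.AlgebraicGeometry.Motives Literature.AlgebraicGeometry.HodgeTheory
open Literature.AlgebraicGeometry.HodgeTheory.BettiUniverse
open Literature.AlgebraicTopology.SingularHomology
open CategoryTheory
open Summit.HodgeConjecture.HodgeConjecture.Theorems.SignSymmetricPowersSevenFacts

/-- **K1-B `VeryGeneralSignCommutatorsInHg` from the deck Hodge numbers and six named facts.**  The hypothesis `hSDH` is
the registered signature of the stub `stub_signDeckHodge` (the `(−1)^j`-eigen-Hodge numbers `shn d j q` of the sign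
involution on `H³` of a very general sign-symmetric threefold of even degree `d ≥ 4`); the rest is the seven-facts proof:
sign-pencil envelope with quasi-projective total space, CDK cover avoided polynomially, Hodge genericity, CMSP 15.3.7 (a
theorem), transport of the `σ`-centraliser to the fibre, `commutator_mem_hodgeGroup_of_signSymmetric`, transport back,
`stub_modelTransfer`.  CONDITIONAL result. [cite: VoisinHodgeII2003, §6.1.3 Thm. 6.10 and Cor. 6.12] -/
theorem veryGeneralSignCommutatorsInHg_of_signDeckHodge
    (hSDH : open Literature.AlgebraicGeometry.Motives Literature.AlgebraicGeometry.HodgeTheory Literature.AlgebraicGeometry.HodgeTheory.BettiUniverse CategoryTheory.Limits in let pmul2 : List (ℕ × ℕ) → List (ℕ × ℕ) → List (ℕ × ℕ) := fun a b => (List.range (a.length + b.length - 1)).map fun k => (((List.range (k + 1)).map fun i => (a.getD i (0, 0)).1 * (b.getD (k - i) (0, 0)).1 + (a.getD i (0, 0)).2 * (b.getD (k - i) (0, 0)).2).sum, ((List.range (k + 1)).map fun i => (a.getD i (0, 0)).1 * (b.getD (k - i) (0, 0)).2 + (a.getD i (0, 0)).2 * (b.getD (k - i) (0, 0)).1).sum);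 let fac : ℕ → Bool → List (ℕ × ℕ) := fun d odd => (List.range (d - 1)).map fun k => if odd ∧ ¬ Even k then (0, 1) else (1, 0); let shn : ℕ → ℕ → ℕ → ℕ := fun d j q => if (q + 1) * d < 5 then 0 else if j = 0 then (([fac d true, fac d false, fac d false, fac d false].foldl pmul2 (fac d true)).getD ((q + 1) * d - 5) (0, 0)).1 else (([fac d true, fac d false, fac d false, fac d false].foldl pmul2 (fac d true)).getD ((q + 1) * d - 5) (0, 0)).2; ∀ ⦃d : ℕ⦄, Even d → 4 ≤ d → ∀ f : MvPolynomial (Fin 5) ℂ, f.IsHomogeneous d → (∀ e : Fin 5 →₀ ℕ, ¬ Even (e 0 + e 1) → f.coeff e = 0) → SmoothHypersurface.IsNonsingularForm ℂ f → ∀ (hXF : IsSmoothProjective 3 (SmoothHypersurface.hypersurface f)) (ha : (fun i : Fin 5 => if (i : ℕ) < 2 then (-1 : ℂˣ) else 1) ∈ diagonalStabilizer f), ∀ j q : ℕ, j < 2 → q ≤ 3 → Module.finrank ℂ ↥(Module.End.eigenspace ((pull (diagonalAut f ha) 3).baseChange ℂ) ((-1 : ℂ) ^ j) ⊓ (hodge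 exists_isReal_hodgeModel_holds hXF 3).piece ((3 : ℤ) - q) q) = shn d j q)
    (hZvK : Literature.AlgebraicGeometry.FundamentalGroup.affineHypersurfaceComplement_meridians_normalClosure_eq_top)
    (hPL : Literature.AlgebraicGeometry.HodgeTheory.picardLefschetz_nodalForms_uniform)
    (hGIC : Literature.AlgebraicGeometry.HodgeTheory.deligne_globalInvariantCycles)
    (hD1 : Literature.AlgebraicGeometry.HodgeTheory.discriminant_localBranches_nodal)
    (hCDK : Literature.AlgebraicGeometry.HodgeTheory.cmsp_nonHodgeGenericPoints_countable_algebraic_cover)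
    (hB2 : Literature.AlgebraicGeometry.HodgeTheory.picardLefschetz_symmetricA3) :
    Summit.HodgeConjecture.HodgeConjecture.Theses.SignSymmetricPowers.VeryGeneralSignCommutatorsInHg := by
  have hMC : Literature.AlgebraicGeometry.FundamentalGroup.affineHypersurfaceComplement_meridian_isConj :=
    Literature.AlgebraicGeometry.FundamentalGroup.affineHypersurfaceComplement_meridian_isConj_holds
  refine Summit.HodgeConjecture.HodgeConjecture.Theorems.SignSymmetricPowersModelTransfer.stub_modelTransfer ?_
  intro d hd h4d
  obtain ⟨𝒳, S, u, hu, h𝒳, hqp, hsm, hirr, hU, A, hA, hfin, pt, hALG, hMEM⟩ :=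
    signPencilEnvelope_of_facts_qp hZvK hPL hGIC hD1 hB2 hMC hd h4d
  haveI hHTF : HodgeTensorFacts.{0, 0} := hodgeTensorFacts_holds
  haveI : ∀ t : ComplexPoints S, Module.Finite ℚ (bettiCohomology (fiberOver u t) 3) := hfin
  -- the Cattani–Deligne–Kaplan cover of the non-Hodge-generic points of the base
  obtain ⟨W, hW, hcov⟩ := hCDK u 3 3 hu hqp hsm hirr hU A hA
  -- each member of the cover is avoided off one nonzero polynomial condition on the ι-even coefficients
  choose G hG₀ hG using fun j => hALG (W j) (hW j).1 (hW j).2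
  -- v5: prepend the nonsingular-avoidance polynomial `g₀`, so that very general members are NONSINGULAR FORMS (this
  -- excludes the degenerate corners `f = c·G^k`, `k ≥ 2`, where `V₊(f)_red` is a smooth threefold of lower degree)
  obtain ⟨g₀, hg₀, hNSg⟩ := Summit.HodgeConjecture.HodgeConjecture.Theorems.SignSymmetricPowersNonsingularAvoidance.stub_signNonsingularAvoidance hd h4d
  refine ⟨fun i => if i = 0 then g₀ else G (i - 1), ?_, ?_⟩
  · intro i
    by_cases hi : i = 0
    · simpa only [hi, if_true] using hg₀
    · simpa only [hi, if_false] using hG₀ (i - 1)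
  intro f hf hev hgen' hXF ha
  have hJ : SmoothHypersurface.IsNonsingularForm ℂ f := hNSg f hf (by simpa only [if_true] using hgen' 0)
  have hgen : ∀ j, MvPolynomial.eval (fun e : {e : Fin 5 →₀ ℕ // e.degree = d} => f.coeff e.1) (G j) ≠ 0 := fun j => by
    simpa only [Nat.succ_ne_zero, if_false, Nat.add_sub_cancel] using hgen' (j + 1)
  -- Deck clauses: `σ_f^{*2} = 1` and `σ_f^*` a `tr ∘ cup` isometry (tree), and the deck Hodge numbers from `hSDH`
  obtain ⟨ha', h1, h2⟩ := exists_signDeckModel_clauses_one_two f hev hXF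
  refine ⟨⟨h1, h2, hSDH hd h4d f hf hev hJ hXF ha'⟩, ?_⟩
  intro g h hg hh
  obtain ⟨φ, B, hB, hBn, τ, hτ, T, D, hNon, hτB, hφτ, hφB, hHG, hT, hD, hspanPos, hconnPos,
    hseedPos, hspanNeg, hconnNeg, hseedNeg⟩ := hMEM f hf hev hJ hXF ha
  haveI := finite hXF 3
  haveI : Nontrivial (bettiCohomology (fiberOver u (pt f)) 3) := hNon
  -- the classifying point of a very general member is Hodge generic
  have hsgen : IsHodgeGenericPoint u 3 hU hu A hA ⟨pt f, Set.mem_univ _⟩ := by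
    by_contra hns
    obtain ⟨j, hj⟩ := hcov ⟨pt f, Set.mem_univ _⟩ hns
    exact hG j f hf hev hXF (hgen j) hj
  -- CMSP 15.3.7 (ii), now a THEOREM (quasi-projective total space, irreducible base): the algebraic monodromy group
  -- `Mon⁰ = (Γ^Zar)⁰` lies in the Mumford–Tate group of the fibre
  have hΓ : glIdentityComponent (ratMonodromyGroup u 3 hU ⟨pt f, Set.mem_univ _⟩) ⊆
      (((A (pt f)).hodgeStructure (hu.isSmoothProjective (pt f)) (hA (pt f)) 3).mumfordTateGroup : Set (bettiCohomology (fiberOver u (pt f)) 3 ≃ₗ[ℚ] bettiCohomology (fiberOver u (pt f)) 3)) :=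
    (deligne_finiteIndex_monodromy_le_mumfordTateGroup_of_isQuasiProjectiveOver u 3 3 hu h𝒳 hqp hsm hirr hU A hA
      ⟨pt f, Set.mem_univ _⟩ hsgen).2
  -- transport the two σ-centraliser isometries to the fibre
  have hστ : ∀ y, τ (φ.symm y) = φ.symm (pull (diagonalAut f ha) 3 y) := fun y => by
    apply φ.injective
    rw [hφτ, LinearEquiv.apply_symm_apply, LinearEquiv.apply_symm_apply]
  have cenτ : ∀ k : bettiCohomology (SmoothHypersurface.hypersurface f) 3 ≃ₗ[ℚ] bettiCohomology (SmoothHypersurface.hypersurface f) 3,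
      (∀ x, k (pull (diagonalAut f ha) 3 x) = pull (diagonalAut f ha) 3 (k x)) →
      ∀ x, ((φ.trans k).trans φ.symm) (τ x) = τ (((φ.trans k).trans φ.symm) x) := by
    intro k hk x
    simp only [LinearEquiv.trans_apply]
    rw [hφτ, hk, hστ]
  have cenB : ∀ k : bettiCohomology (SmoothHypersurface.hypersurface f) 3 ≃ₗ[ℚ] bettiCohomology (SmoothHypersurface.hypersurface f) 3,
      (∀ x y, tr hXF (3 + 3) (cup (SmoothHypersurface.hypersurface f) 3 3 (k x) (k y)) = tr hXF (3 + 3) (cup (SmoothHypersurface.hypersurface f) 3 3 x y)) →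
      ∀ x y, B (((φ.trans k).trans φ.symm) x) (((φ.trans k).trans φ.symm) y) = B x y := by
    intro k hk x y
    simp only [LinearEquiv.trans_apply]
    rw [hφB, LinearEquiv.apply_symm_apply, LinearEquiv.apply_symm_apply, hk, ← hφB]
  -- Theorem A's algebra (landed): commutators of the sign-symmetric centraliser of the fibre lie in its Hodge group
  have hcomm := commutator_mem_hodgeGroup_of_signSymmetric ((A (pt f)).hodgeStructure (hu.isSmoothProjective (pt f)) (hA (pt f)) 3)
    (smoothProjective_hodgeStructure_isPolarizable_holds (hu.isSmoothProjective (pt f)) (A (pt f))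
      (hA (pt f)) 3) ⟨1, by norm_num⟩ hB hBn hτ hτB hΓ hT hD hspanPos hconnPos hseedPos hspanNeg hconnNeg
    hseedNeg (cenτ g hg.1) (cenB g hg.2) (cenτ h hh.1) (cenB h hh.2)
  -- transport back to `H³(X_f;ℚ)` along `φ` (Hodge groups correspond)
  have hback := hHG _ hcomm
  have hid : (φ.symm.trans (((φ.trans g).trans φ.symm) * ((φ.trans h).trans φ.symm) *
      ((φ.trans g).trans φ.symm)⁻¹ * ((φ.trans h).trans φ.symm)⁻¹)).trans φ = g * h * g⁻¹ * h⁻¹ := by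
    have hinv : ∀ k : bettiCohomology (SmoothHypersurface.hypersurface f) 3 ≃ₗ[ℚ] bettiCohomology (SmoothHypersurface.hypersurface f) 3,
        ((φ.trans k).trans φ.symm)⁻¹ = (φ.trans k⁻¹).trans φ.symm := by
      intro k
      rw [inv_eq_iff_mul_eq_one]
      ext x
      simp
    rw [hinv, hinv]
    ext x
    simp
  rw [hid] at hback
  exact hback

/-- **K1-B modulo SEVEN named facts, residue-KERNEL form**: `Griffiths1969_residueKernel_eq_jacobianIdeal` (Voisin II
Thm. 6.10 — the fact route A's `CyclicUnitaryPowersFourFacts` also binds), ZvK generation of `π₁` of affine hypersurface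
complements by meridians, uniform Picard–Lefschetz for nodal forms, Deligne's global invariant cycles, nodal local branches
of the discriminant, the Cattani–Deligne–Kaplan cover, and the symmetric `A₃` vanishing lattice.  CONDITIONAL result.
[cite: VoisinHodgeII2003, §6.1.3 Thm. 6.10 and Cor. 6.12] -/
theorem veryGeneralSignCommutatorsInHg_of_seven_facts_kernel
    (hG : Literature.AlgebraicGeometry.HodgeTheory.Griffiths1969_residueKernel_eq_jacobianIdeal)
    (hZvK : Literature.AlgebraicGeometry.FundamentalGroup.affineHypersurfaceComplement_meridians_normalClosure_eq_top)
    (hPL : Literature.AlgebraicGeometry.HodgeTheory.picardLefschetz_nodalForms_uniform)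
    (hGIC : Literature.AlgebraicGeometry.HodgeTheory.deligne_globalInvariantCycles)
    (hD1 : Literature.AlgebraicGeometry.HodgeTheory.discriminant_localBranches_nodal)
    (hCDK : Literature.AlgebraicGeometry.HodgeTheory.cmsp_nonHodgeGenericPoints_countable_algebraic_cover)
    (hB2 : Literature.AlgebraicGeometry.HodgeTheory.picardLefschetz_symmetricA3) :
    Summit.HodgeConjecture.HodgeConjecture.Theses.SignSymmetricPowers.VeryGeneralSignCommutatorsInHg :=
  veryGeneralSignCommutatorsInHg_of_signDeckHodge
    (SignSymmetricPowersSignDeckHodgeKernel.stub_signDeckHodge_of_residueKernel hG) @hZvK @hPL @hGIC @hD1 @hCDK @hB2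

/-- **The rung leaf `SignThreefoldPowersHodge` modulo the same SEVEN named facts (residue-kernel form)** — composition with
the landed `signThreefoldPowersHodge_of_veryGeneralSignCommutatorsInHg`.  CONDITIONAL result; rung F-H1 not moved.
[cite: VoisinHodgeII2003, §6.1.3 Thm. 6.10 and Cor. 6.12] -/
theorem signThreefoldPowersHodge_of_seven_facts_kernel
    (hG : Literature.AlgebraicGeometry.HodgeTheory.Griffiths1969_residueKernel_eq_jacobianIdeal)
    (hZvK : Literature.AlgebraicGeometry.FundamentalGroup.affineHypersurfaceComplement_meridians_normalClosure_eq_top)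
    (hPL : Literature.AlgebraicGeometry.HodgeTheory.picardLefschetz_nodalForms_uniform)
    (hGIC : Literature.AlgebraicGeometry.HodgeTheory.deligne_globalInvariantCycles)
    (hD1 : Literature.AlgebraicGeometry.HodgeTheory.discriminant_localBranches_nodal)
    (hCDK : Literature.AlgebraicGeometry.HodgeTheory.cmsp_nonHodgeGenericPoints_countable_algebraic_cover)
    (hB2 : Literature.AlgebraicGeometry.HodgeTheory.picardLefschetz_symmetricA3) :
    Summit.HodgeConjecture.HodgeConjecture.Theses.SignSymmetricPowers.SignThreefoldPowersHodge :=
  SignSymmetricPowersSignThreefoldPowersHodge.signThreefoldPowersHodge_of_veryGeneralSignCommutatorsInHg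
    (veryGeneralSignCommutatorsInHg_of_seven_facts_kernel @hG @hZvK @hPL @hGIC @hD1 @hCDK @hB2)

end Summit.HodgeConjecture.HodgeConjecture.Theorems.SignSymmetricPowersSevenFactsKernel

end
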